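import Summits.ResolutionOfSingularities.ResolutionOfSingularities.Theorems.PurelyInseparableDim4ResConePrimeShadeTail
import Summits.ResolutionOfSingularities.ResolutionOfSingularities.Theorems.PurelyInseparableDim4ResConeFrozenConeEntry
import Summits.ResolutionOfSingularities.ResolutionOfSingularities.Theorems.PurelyInseparableDim4ResConeHeavyLoseTailLetters
import Summits.ResolutionOfSingularities.ResolutionOfSingularities.Theorems.PurelyInseparableDim4ResConeGoodModuloFrozen
import Summits.ResolutionOfSingularities.ResolutionOfSingularities.Theorems.PurelyInseparableDim4ResConeActiveThreshold
import Summits.ResolutionOfSingularities.ResolutionOfSingularities.Theorems.PurelyInseparableDim4IsolatedMultiplicityPairs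
import HarnessLib
import HarnessLib.Audit.Tags

/-!
# Purely inseparable four-folds — TAIL(p, d, 2) = ∅ FOR EVERY PRIME `p` AND EVERY SHADE `1 ≤ d < p`, MODULO THE KEEP LAW WITH A
# FROZEN CONE MONOMIAL (the e = 2 side of the K2(p) ledger as ONE assembly; cell `res-dim4-pi`, K2(p) lane, rung-2 row E-CONE)

[OURS · counted 0 · cell `res-dim4-pi` · K2(p) lane holder res-dim4-p-12 g5 (rulings g5-4 (5), g5-6, g5-8; exit table v4 §E).]
**HONEST LABEL.**  A theorem about OUR MODEL (the coordinate point-blow-up walk `Step0 p` with cleaning on presented states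
`(F, r, exc)` of `z^p + F(x₁..x₄)`, ISOLATED regime), CONDITIONAL on ONE step law that is typed elsewhere in the lane and not yet
landed — the KEEP law with a frozen cone monomial (K_set, binder `hK` below, owner res-dim4-p-7 g5).  GIVEN that law, there is no
witnessed isolated above-floor `Step0 p` chain of constant shade `d` (`1 ≤ d < p`) with binary residual cone (`e_G ≡ 2`): the whole
`e = 2` half of the K2(p) ledger (`noAboveFloorTrap_iff_highTails`, p710010) for every prime at once.  Nothing here proves K2(p) (the
power-cone tails TAIL(p, d, 3) are untouched), `NoIsolatedTrap p p`, CJS Key Theorem 6.40 or resolution of singularities in dimension ≥ 4 /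
characteristic `p` — NOT proved; and the `e = 2` statement itself is proved here only MODULO `hK`.  AI kernel work, weaker than
expert review.

THE ASSEMBLY (all inputs are tree theorems of the cell, by name):
* STRUCTURE (res-dim4-p-5 g5 `good_modulo_frozen`): from some `M ≥ k₀` on there is a PERMANENT set `P` (never charted, never translated,
  weights ≥ 1) with FROZEN LIGHT weight `W := Σ_{z∈P} r_M z`, `d + W < p`, outside which every state is GOOD (≤ 2 boundary letters,
  pairwise TT); by res-dim4-p-9 g5 `permanentSet_coneLetters` every `z ∈ P` is a CONE letter at every `k ≥ M` (E-TRANS is empty).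
* THRESHOLD `ℓ := p − d − W` (res-dim4-p-5 g5 `…ActiveThreshold`): an active letter of weight `≥ ℓ` exists at every `k ≥ M`
  (`exists_active_ge_threshold`), and when a step touches an active letter of weight `≥ ℓ` the newborn weighs `≥ ℓ`
  (`threshold_le_newborn_of_touch`) — NO fall-off at any effective threshold.
* START: if no active letter of weight `≥ ℓ` is ever hit after `M`, the one present at `M` is permanent and `P ∪ {it}` has frozen weight
  `≥ p − d` — excluded by res-dim4-p-5 g5 `no_tail_of_permanent_weight_ge`.  So some step `k₁ ≥ M` hits an active `h ∉ P` with
  `r h ≥ ℓ`: E_set (res-dim4-p-9 g5 `tail_entryFrame_frozenCone_of_hit`, `n := p − r h − W`) and L_set (res-dim4-p-2 g6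
  `tail_heavy_lose_step_letters`, `m := p − w′ − W`, cone set `P`) frame the newborn at `k₁ + 1` with `0 < αs`.
* RUN: the one-tracked frame (`no_tail_of_tracked_frame`, p712057 §2) with run datum «`h ∉ P`, `ℓ ≤ r_k h`, frame 5-tuple, `0 < αs`»
  and `Φ := βs`; (L) = L_set + `threshold_le_newborn_of_touch`; (K) = `hK`.  The tracked letter is kept only `βs₀` times, so it is
  eventually hit at every step — a FREE tail, against FT.

THE HYPOTHESIS `hK` (to be discharged by res-dim4-p-7 g5's K_set, the KEEP twin of `tail_heavy_lose_step_letters`): for the frozen set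
`P` (permanent from `M ≥ k₀`, weights ≥ 1) and any `k ≥ M`, an active letter `h ∉ P` with `p ≤ r_k h + W + d` that the step KEEPS
(`j k ≠ h`, `b k h = 0`) passes a run frame `(L, M)` at `k` with `u₁ = e_h` and `0 < αs` to a run frame at `k + 1` with `u₁ = e_h`,
`0 < αs` and `βs` STRICTLY smaller.  At `P = ∅` this is res-dim4-p-7 g5's landed `tail_heavy_keep_step` (p710511) with `n := p − r_k h`.

[cite: CossartJannsenSaito2020, Thm. 3.14, Lemma 13.4 (3), Thm. 13.7] [cite: CossartPiltant2008, (16), Lemma 4.5 (2)]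
[cite: HauserPerlega2019PRIMS, §2 (transform D′ of D)]
bears_on: LADDER-RESOLUTION:D157-DOOR2 (res-dim4-pi · K2(p) · TAIL(p, d, 2) = ∅ ∀ (p, d) modulo K_set · rung-2 row E-CONE assembly).
Supports stmt-ResolutionOfSingularities-16155 (helper).
-/

set_option linter.dupNamespace false -- mandated namespace of this single-conjunct summit

noncomputable section

namespace Summit.ResolutionOfSingularities.ResolutionOfSingularities.Theorems.PIDim4

namespace ResCone

open MvPolynomial Finset
open Literature.AlgebraicGeometry.Resolution
open Literature.AlgebraicGeometry.Resolution.CentreBlowup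
open Literature.AlgebraicGeometry.Resolution.Hauser2010
open Literature.AlgebraicGeometry.Resolution.HauserPerlega2019
open Literature.AlgebraicGeometry.Resolution.WeightedOrder
open PointBlowup (direction)

variable {K : Type} [Field K]

section FrozenCone

variable (p : ℕ) [hp : Fact p.Prime] [CharP K p] [DecidableEq K]

/-- **TAIL(p, d, 2) = ∅ FOR EVERY PRIME `p` AND EVERY SHADE `1 ≤ d < p`, MODULO THE KEEP LAW WITH A FROZEN CONE MONOMIAL.**
Along a witnessed isolated above-floor `Step0 p` chain `c j b` with `x^{r₀} ∣ F₀`, constant shade `d` and `e_G ≡ 2` from `k₀`, assume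
the KEEP law `hK` (for every permanent set `P` from `M ≥ k₀` with weights ≥ 1, every `k ≥ M` and every kept active letter `h ∉ P` with
`p ≤ r_k h + Σ_{z∈P} r_M z + d`, a run frame with `u₁ = e_h` and `0 < αs` passes to the child with `βs` strictly smaller).  Then `False`:
`good_modulo_frozen` (res-dim4-p-5) + `permanentSet_coneLetters` (res-dim4-p-9) + `exists_active_ge_threshold` /
`threshold_le_newborn_of_touch` (res-dim4-p-5) + `no_tail_of_permanent_weight_ge` (res-dim4-p-5) + E_set `tail_entryFrame_frozenCone_of_hit`
(res-dim4-p-9) + L_set `tail_heavy_lose_step_letters` (res-dim4-p-2) + the one-tracked frame `no_tail_of_tracked_frame` (p712057).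
[OURS · conditional on `hK` only] [cite: CossartJannsenSaito2020, Thm. 3.14, Lemma 13.4 (3), Thm. 13.7] -/
theorem no_binaryCone_tail_of_keepLaw {c : ℕ → State K} {j : ℕ → Fin 4} {b : ℕ → Fin 4 → K}
    (hc : ∀ k, IsIsolated p (c k).F ∧ Step0 p (c k) (c (k + 1))) (hw : FreeTail.IsWitnessedChain p c j b)
    (hr0 : ∀ e ∈ (c 0).F.support, (c 0).r ≤ e) (hfloor : ∀ k, ordZero (c k).F ≠ p) {k₀ d : ℕ} (hd : 1 ≤ d) (hdp : d < p)
    (hshade : ∀ k, k₀ ≤ k → (c k).shade = (d : ℕ∞))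
    (he : ∀ k, k₀ ≤ k → Module.finrank K (resVertex (c k)) = 2)
    (hK : ∀ (M : ℕ) (P : Finset (Fin 4)), k₀ ≤ M →
      (∀ z ∈ P, ∀ m, M ≤ m → 1 ≤ (c m).r z ∧ z ≠ j m ∧ b m z = 0) →
      ∀ k, M ≤ k → ∀ (h : Fin 4), h ∉ P → p ≤ (c k).r h + (∑ z ∈ P, (c M).r z) + d → j k ≠ h → b k h = 0 →
      ∀ (L : Fin (2 + 2) → Fin 4 → K) (Mx : Fin 4 → Fin (2 + 2) → K),
        (∀ t u, ∑ i, Mx t i * L i u = if t = u then 1 else 0) → L (u1 2) = Pi.single h 1 →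
        (∀ i, i ≠ u1 2 → i ≠ u2 2 → ∀ w ∈ resVertex (c k), ∑ t, L i t * w t = 0) →
        (pts (fun i => algebraMap (MvPolynomial (Fin 4) K) (OriginLocalization K 4) (∑ t, C (L i t) * X t))
          (Ideal.span {algebraMap (MvPolynomial (Fin 4) K) (OriginLocalization K 4)
            ((c k).F.divMonomial (c k).r)}) d).Nonempty →
        Nat.factorial d < deltaS (fun i => algebraMap (MvPolynomial (Fin 4) K) (OriginLocalization K 4) (∑ t, C (L i t) * X t))
          (Ideal.span {algebraMap (MvPolynomial (Fin 4) K) (OriginLocalization K 4)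
            ((c k).F.divMonomial (c k).r)}) d →
        0 < alphaS (fun i => algebraMap (MvPolynomial (Fin 4) K) (OriginLocalization K 4) (∑ t, C (L i t) * X t))
          (Ideal.span {algebraMap (MvPolynomial (Fin 4) K) (OriginLocalization K 4)
            ((c k).F.divMonomial (c k).r)}) d →
        ∃ (L' : Fin (2 + 2) → Fin 4 → K) (M' : Fin 4 → Fin (2 + 2) → K),
          ((∀ t u, ∑ i, M' t i * L' i u = if t = u then 1 else 0) ∧ L' (u1 2) = Pi.single h 1 ∧
            (∀ i, i ≠ u1 2 → i ≠ u2 2 → ∀ w ∈ resVertex (c (k + 1)), ∑ t, L' i t * w t = 0) ∧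
            (pts (fun i => algebraMap (MvPolynomial (Fin 4) K) (OriginLocalization K 4) (∑ t, C (L' i t) * X t))
              (Ideal.span {algebraMap (MvPolynomial (Fin 4) K) (OriginLocalization K 4)
                ((c (k + 1)).F.divMonomial (c (k + 1)).r)}) d).Nonempty ∧
            Nat.factorial d < deltaS (fun i => algebraMap (MvPolynomial (Fin 4) K) (OriginLocalization K 4)
              (∑ t, C (L' i t) * X t)) (Ideal.span {algebraMap (MvPolynomial (Fin 4) K) (OriginLocalization K 4)
                ((c (k + 1)).F.divMonomial (c (k + 1)).r)}) d) ∧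
          0 < alphaS (fun i => algebraMap (MvPolynomial (Fin 4) K) (OriginLocalization K 4) (∑ t, C (L' i t) * X t))
            (Ideal.span {algebraMap (MvPolynomial (Fin 4) K) (OriginLocalization K 4)
              ((c (k + 1)).F.divMonomial (c (k + 1)).r)}) d ∧
          betaS (fun i => algebraMap (MvPolynomial (Fin 4) K) (OriginLocalization K 4) (∑ t, C (L' i t) * X t))
              (Ideal.span {algebraMap (MvPolynomial (Fin 4) K) (OriginLocalization K 4)
                ((c (k + 1)).F.divMonomial (c (k + 1)).r)}) d <
            betaS (fun i => algebraMap (MvPolynomial (Fin 4) K) (OriginLocalization K 4) (∑ t, C (L i t) * X t))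
              (Ideal.span {algebraMap (MvPolynomial (Fin 4) K) (OriginLocalization K 4)
                ((c k).F.divMonomial (c k).r)}) d) : False := by
  classical
  -- STRUCTURE: the frozen light set `P`, GOOD outside it, cone letters
  obtain ⟨M, hM, P, hPcard, hWlt, hperm, hgood⟩ := good_modulo_frozen p hc hw hr0 hfloor hdp hshade he
  set W := ∑ z ∈ P, (c M).r z with hWdef
  have hperm' : ∀ z ∈ P, ∀ m, M ≤ m → z ≠ j m ∧ b m z = 0 :=
    fun z hz m hm => ⟨(hperm z hz m hm).2.1, (hperm z hz m hm).2.2⟩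
  have hperm'' : ∀ z ∈ P, ∀ k, M ≤ k → j k ≠ z ∧ b k z = 0 :=
    fun z hz k hk => ⟨((hperm z hz k hk).2.1).symm, (hperm z hz k hk).2.2⟩
  have hfrozen : ∀ m, M ≤ m → ∑ z ∈ P, (c m).r z = W := fun m hm => sum_frozen_of_permanent p hc hw hfloor hperm' hm
  have hcone : ∀ z ∈ P, ∀ k, M ≤ k → ∀ v ∈ resVertex (c k), v z = 0 :=
    permanentSet_coneLetters hc hw hr0 hfloor hshade he hM hperm''
  have hjP : ∀ k, M ≤ k → j k ∉ P := fun k hk hjk => (hperm'' (j k) hjk k hk).1 rfl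
  obtain ⟨-, hlaw, hbj, hband, hpair⟩ := tail_weights_laws hc hw hr0 hfloor hshade
  -- a kept letter keeps its weight
  have hkept : ∀ k, k₀ ≤ k → ∀ (h : Fin 4), j k ≠ h → b k h = 0 → (c (k + 1)).r h = (c k).r h := by
    intro k hk h hjh hbh
    rw [hlaw k hk, Finsupp.coe_update, Function.update_of_ne (Ne.symm hjh),
      Finsupp.filter_apply_pos (fun i => b k i = 0) ((c k).r) hbh]
  -- an active letter next to the frozen set weighs at most `p − 1 − W` (pair / triple laws, `#P ≤ 2`)
  have hbound : ∀ k (i : Fin 4), i ∉ P → (c k).r i + ∑ z ∈ P, (c k).r z ≤ p - 1 := by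
    intro k i hiP
    have hrk := IsolatedBand.isolated_chain_forall_le hc hr0 k
    rcases Nat.lt_or_ge P.card 1 with h0 | h1
    · have hP0 : P = ∅ := Finset.card_eq_zero.mp (show P.card = 0 by omega)
      obtain ⟨i', hi'⟩ := exists_ne i
      have := hpair k i i' (Ne.symm hi')
      rw [hP0, Finset.sum_empty]
      omega
    · rcases Nat.lt_or_ge P.card 2 with h2 | h2
      · obtain ⟨z, hPz⟩ := Finset.card_eq_one.mp (show P.card = 1 by omega)
        have hiz : i ≠ z := fun h => hiP (by rw [hPz, h]; exact Finset.mem_singleton_self z)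
        have := hpair k i z hiz
        rw [hPz, Finset.sum_singleton]
        omega
      · obtain ⟨z₁, z₂, hz, hPz⟩ := Finset.card_eq_two.mp (show P.card = 2 by omega)
        have hi1 : i ≠ z₁ := fun h => hiP (by rw [hPz, h]; simp)
        have hi2 : i ≠ z₂ := fun h => hiP (by rw [hPz, h]; simp)
        have := IsolatedBand.apply_add_add_le_of_isIsolated (hc k).1 hrk hi1 hi2 hz
        rw [hPz, Finset.sum_pair hz]
        omega
  -- the effective threshold `ℓ := p − d − W`
  have hℓ : d + ∑ z ∈ P, (c M).r z + (p - d - W) = p := by rw [← hWdef]; omega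
  -- START: some step `k₁ ≥ M` hits an active letter of weight `≥ ℓ`
  have hstart : ∃ k, M ≤ k ∧ ∃ h : Fin 4, h ∉ P ∧ p - d - W ≤ (c k).r h ∧ (j k = h ∨ b k h ≠ 0) := by
    by_contra hno
    push Not at hno
    obtain ⟨i, hiP, hi⟩ := exists_active_ge_threshold p hc hw hr0 hfloor hshade hM hperm hgood hℓ (m := M) le_rfl
    -- `i` is then permanent with frozen weight `≥ ℓ`
    have hfrz : ∀ m, M ≤ m → (c m).r i = (c M).r i ∧ (j m ≠ i ∧ b m i = 0) := by
      intro m hm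
      induction m, hm using Nat.le_induction with
      | base => exact ⟨rfl, hno M le_rfl i hiP hi⟩
      | succ m hm ih =>
        obtain ⟨hrm, hjm, hbm⟩ := ih
        have hrm1 : (c (m + 1)).r i = (c M).r i := by rw [hkept m (by omega) i hjm hbm, hrm]
        exact ⟨hrm1, hno (m + 1) (by omega) i hiP (by rw [hrm1]; exact hi)⟩
    refine no_tail_of_permanent_weight_ge p hc hw hr0 hfloor hshade hM (P := insert i P) ?_ ?_
    · intro z hz m hm
      rcases Finset.mem_insert.mp hz with rfl | hzP
      · exact ⟨((hfrz m hm).2.1).symm, (hfrz m hm).2.2⟩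
      · exact hperm' z hzP m hm
    · rw [Finset.sum_insert hiP]
      omega
  obtain ⟨k₁, hk₁, h, hhP, hh, hhit⟩ := hstart
  have hk₁0 : k₀ ≤ k₁ := by omega
  -- E_set at `k₁` on `h` (`n := p − r h − W`)
  obtain ⟨L₀, M₀, hM₀, hL₀u1, hy₀, hne₀, hδ₀, -⟩ := tail_entryFrame_frozenCone_of_hit (p := p) hdp
    (n := p - (c k₁).r h - W) (by omega) hc hw hr0 hfloor hshade he hM hperm'' hk₁ hhP hhit
    (by rw [hfrozen k₁ hk₁]; omega)
  -- L_set across step `k₁` (`m := p − w′ − W`, `w′` the newborn weight)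
  obtain ⟨hnew₁, -, hnewlt₁, -⟩ := tail_newborn_weight hc hw hr0 hfloor hshade hk₁0
  have hthr₁ : p - d - W ≤ (c (k₁ + 1)).r (j k₁) :=
    threshold_le_newborn_of_touch p hc hw hr0 hfloor hshade hM hperm hgood hℓ hk₁ hhP hh hhit
  have hbd₁ := hbound (k₁ + 1) (j k₁) (hjP k₁ hk₁)
  rw [hfrozen (k₁ + 1) (by omega)] at hbd₁
  obtain ⟨L₁, M₁, ⟨hM₁, hL₁u1, hy₁, hne₁, hδ₁, -⟩, hpos₁, -⟩ := tail_heavy_lose_step_letters (p := p) hdp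
    (m := p - ((c k₁).r.degree + d - p) - W) (by rw [← hnew₁]; omega) (by rw [← hnew₁]; omega)
    hc hw hr0 hfloor hshade he hk₁0 (heavyLine_direction_ne_zero (hbj k₁) hhit) P (fun z hz => hcone z hz k₁ hk₁)
    (by rw [Finset.sum_insert (hjP k₁ hk₁), hnew₁, hfrozen (k₁ + 1) (by omega)]; omega) (by omega)
    hM₀ hL₀u1 hy₀ hne₀ hδ₀
  -- RUN: the one-tracked frame with run datum «active, weight ≥ ℓ, framed, 0 < αs»
  refine no_tail_of_tracked_frame p hc hw (k₁ := k₁ + 1)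
    (Fr := (Fin (2 + 2) → Fin 4 → K) × (Fin 4 → Fin (2 + 2) → K))
    (fun k i f => (i ∉ P ∧ p - d - W ≤ (c k).r i) ∧
      (∀ t u, ∑ s, f.2 t s * f.1 s u = if t = u then 1 else 0) ∧ f.1 (u1 2) = Pi.single i 1 ∧
      (∀ s, s ≠ u1 2 → s ≠ u2 2 → ∀ w ∈ resVertex (c k), ∑ t, f.1 s t * w t = 0) ∧
      (pts (fun s => algebraMap (MvPolynomial (Fin 4) K) (OriginLocalization K 4) (∑ t, C (f.1 s t) * X t))
        (Ideal.span {algebraMap (MvPolynomial (Fin 4) K) (OriginLocalization K 4)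
            ((c k).F.divMonomial (c k).r)}) d).Nonempty ∧
      Nat.factorial d < deltaS (fun s => algebraMap (MvPolynomial (Fin 4) K) (OriginLocalization K 4) (∑ t, C (f.1 s t) * X t))
        (Ideal.span {algebraMap (MvPolynomial (Fin 4) K) (OriginLocalization K 4)
            ((c k).F.divMonomial (c k).r)}) d ∧
      0 < alphaS (fun s => algebraMap (MvPolynomial (Fin 4) K) (OriginLocalization K 4) (∑ t, C (f.1 s t) * X t))
        (Ideal.span {algebraMap (MvPolynomial (Fin 4) K) (OriginLocalization K 4)
            ((c k).F.divMonomial (c k).r)}) d)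
    (fun k f => betaS (fun s => algebraMap (MvPolynomial (Fin 4) K) (OriginLocalization K 4) (∑ t, C (f.1 s t) * X t))
        (Ideal.span {algebraMap (MvPolynomial (Fin 4) K) (OriginLocalization K 4)
            ((c k).F.divMonomial (c k).r)}) d)
    ?_ ?_ (h₀ := j k₁) (f₀ := ⟨L₁, M₁⟩) ⟨⟨hjP k₁ hk₁, hthr₁⟩, hM₁, hL₁u1, hy₁, hne₁, hδ₁, hpos₁⟩
  · -- (L): the frame follows the hit onto the newborn (no fall-off: `threshold_le_newborn_of_touch`)
    rintro k hk h' ⟨L, Mx⟩ ⟨⟨hh'P, hh'⟩, hMx, hLu1, hy, hne, hδ, -⟩ hhit'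
    have hk0 : k₀ ≤ k := by omega
    have hkM : M ≤ k := by omega
    obtain ⟨hnew, -, hnewlt, -⟩ := tail_newborn_weight hc hw hr0 hfloor hshade hk0
    have hthr : p - d - W ≤ (c (k + 1)).r (j k) :=
      threshold_le_newborn_of_touch p hc hw hr0 hfloor hshade hM hperm hgood hℓ hkM hh'P hh' hhit'
    have hbd := hbound (k + 1) (j k) (hjP k hkM)
    rw [hfrozen (k + 1) (by omega)] at hbd
    obtain ⟨L', M', ⟨hM', hL'u1, hy', hne', hδ', -⟩, hpos', hle'⟩ := tail_heavy_lose_step_letters (p := p) hdp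
      (m := p - ((c k).r.degree + d - p) - W) (by rw [← hnew]; omega) (by rw [← hnew]; omega)
      hc hw hr0 hfloor hshade he hk0 (heavyLine_direction_ne_zero (hbj k) hhit') P (fun z hz => hcone z hz k hkM)
      (by rw [Finset.sum_insert (hjP k hkM), hnew, hfrozen (k + 1) (by omega)]; omega) (by omega)
      hMx hLu1 hy hne hδ
    exact ⟨⟨L', M'⟩, ⟨⟨hjP k hkM, hthr⟩, hM', hL'u1, hy', hne', hδ', hpos'⟩, hle'⟩
  · -- (K): the KEEP law with the frozen cone monomial (hypothesis `hK`)
    rintro k hk h' ⟨L, Mx⟩ ⟨⟨hh'P, hh'⟩, hMx, hLu1, hy, hne, hδ, hα0⟩ hjh hbh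
    have hk0 : k₀ ≤ k := by omega
    have hkM : M ≤ k := by omega
    obtain ⟨L', M', ⟨hM', hL'u1, hy', hne', hδ'⟩, hpos', hlt'⟩ := hK M P hM hperm k hkM h' hh'P
      (by omega) hjh hbh L Mx hMx hLu1 hy hne hδ hα0
    exact ⟨⟨L', M'⟩, ⟨⟨hh'P, by rw [hkept k hk0 h' hjh hbh]; exact hh'⟩, hM', hL'u1, hy', hne', hδ', hpos'⟩, hlt'⟩

end FrozenCone

end ResCone

end Summit.ResolutionOfSingularities.ResolutionOfSingularities.Theorems.PIDim4

end
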